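import Literature.NumberTheory.LFunctions.ThetaChainExtCheck
import HarnessLib

/-!
# Schoenfeld's `θ`-bound on `[599, e¹⁶]` by kernel computation: extended run, chunk 14 of 14
# (plan N2 of provefact `Literature.NumberTheory.LFunctions.robin_iff`)

Topic: `Literature/NumberTheory/LFunctions`. Pure proof file (a kernel computation; nothing is
asserted, no definition). `xrun14` evaluates `ThetaChain.runDExt 20000 260000` — at most `20000`
self-contained steps of the `θ`-chain (`ThetaChain.stepExt`, `ThetaChainExtCheck.lean`: primality of
the next data entry and compositeness of the odd numbers skipped, by gcds with the product of the
odd primes `≤ 2999`; the enclosures of `log p`, `θ(p)`; the two comparisons behind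
`|θ(x) − x| ≤ √x log² x/(8π)`) over the data entries from position `260000` — on the state reached
before (the literal on the left: the prime `8680043` with its enclosures, recorded by
chunk 13) and records the resulting state (the prime `8886113`,
data entry `272901`). Soundness: `ThetaChain.runDExt_sound` (`ThetaChainExtSound.lean`), for
arbitrary data; assembly of the 14 chunks: `ThetaSmallRange.lean`. The expected states were
obtained by evaluating the same function outside the kernel. `decide +kernel`, standard axioms only
(about one minute of kernel time; `maxHeartbeats 0` lifts the deterministic time-out for this one
declaration).

## References

* L. Schoenfeld, *Sharper bounds for the Chebyshev functions θ(x) and ψ(x). II*, Math. Comp. 30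
  (1976), 337–360, Thm. 10 (6.3) and p. 339. [Schoenfeld1976]
-/

namespace Literature.NumberTheory.LFunctions.ThetaChainRun

open ThetaChain

set_option maxHeartbeats 0 in
/-- **Chunk 14 of the extended certified `θ`-run** (data entries `260000` to `272901`, primes
`8680043` to `8886113`). [cite: Schoenfeld1976, Thm. 10 (6.3)] -/
theorem xrun14 :
    runDExt 20000 260000
      ⟨8680043, 19314448136339652448399343, 19314448136340128067934421,
        10489805237100272399831442229955, 10489805237100549415378347479577⟩ =
    some ⟨8886113, 19342813451160451275473379, 19342813451160926895289126,
        10739163612930417185419074987374, 10739163612930700336935412219133⟩ := by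
  decide +kernel

end Literature.NumberTheory.LFunctions.ThetaChainRun
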